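import Mathlib
import Summits.NavierStokesRegularity.FluidComputer.SkewCutGalerkinFromSections
import Summits.NavierStokesRegularity.FluidComputer.BorderedEigenpairPairingSections

/-!
# Skew-cut X0 certificate END-TO-END FROM MATRIX DATA: the bracket-end injectivity `hinj` from
# Theorem-R (resolvent) data and the section pairing bound (diagonal / Hilbert-basis setting)
(profile-cert-3 g6, cell `ns-blowup`, 2026-08-26)

HONEST FRAMING (human rulings D-0035/D-0074): nothing here is a claim about Navier–Stokes
blow-up. WHAT THIS IS NOT: not NS evidence. MODEL lane bookkeeping about the FORMAT of the
GROUP-A X0 certificates (`SkewCutCertificate`, `SkewCutBracketTranscript/Reproductions`, two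
implementations) — the GROUP-A twin of `BorderedEigenpairPairingSections` §4. No certificate,
printed number or census word is moved.

instab4's `SkewCutGalerkinFromSections.exists_smooth_eigenvector_Ioo_of_sections'` (p446013 +
append) takes the section eigenpairs as MATRIX data but keeps Theorem 1′ (a) — «the bracket ends
`a`, `e` are not eigenvalues», i.e. injectivity of `R_a`, `R_e` for the Schur operator of `t` — as
the operator-form hypothesis `hinj`. Theorem R from matrix data
(`ResolventFromSections.resolvent_inverse_of_sections`, p466288; with the pairing bound from
sections: `BorderedEigenpairPairingSections.resolvent_inverse_of_sections_of_sections`, p471063)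
delivers MORE at any point `z`: a two-sided inverse of `R_z`. Hence (§1) injectivity of `R_z` for
EVERY operator with matrix `t` (the Schur operator is unique), from: a left inverse `Binv` of the
Galerkin matrix `z − L_K` with its three bounds `α, β_B, β_C`, the SHELL inequality with `MU2 > 0`,
the TAIL CONSTANT, and the section pairing hypothesis
`hA : Re Σ_{i,j∈F} conj(e_i) a_ij e_j ≤ s Σ_{i∈F} |e_i|²`; and (§2) the GROUP-A END-TO-END statement
with `hinj` REPLACED by two such data sets, one per bracket end
(`exists_smooth_eigenvector_Ioo_of_sections_of_resolvent_data`).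

What stays model-specific (identical to GROUP B's residue, `HOME/instab4/KERNEL-CHAIN.md` §4 /
`HOME/profile/cert/impl3/INSTANTIATION-3B.md` §5): the class-II families and the finite
identification of the certifiers' matrices (definitions lane), instab4's pairing bound (kernel),
the transcribed numbers (certifier audit). Mathlib + the files named; no new definitions.
bears_on LADDER-NS N1* ⟦I-X0⟧ / N5 Z4-a; evidence-only for `EpisodeBase`
(stmt-NavierStokesRegularity-19179). [folklore] throughout.
-/

noncomputable section

namespace Summit.NavierStokesRegularity.FluidComputer.SkewCutGalerkinFromResolventData

open Filter Topology Submodule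
open scoped InnerProductSpace ComplexConjugate

variable {𝕜 H : Type*} [RCLike 𝕜] [NormedAddCommGroup H] [InnerProductSpace 𝕜 H] [CompleteSpace H]
variable {ι : Type*} (b : HilbertBasis ι 𝕜 H) [DecidableEq ι]

/-! ## §1 Injectivity of `R_z` for every operator with matrix `t`, from Theorem-R data -/

/-- **`R_z` is injective** for EVERY bounded `T'` with `⟪b i, T' b j⟫ = t_ij` that is the unique
such operator (as the Schur operator is), from the Theorem-R matrix data at `z` and the section
pairing bound: Theorem R gives a two-sided inverse of `R_z = 1 − T − (x₀ − z) S₀`. -/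
theorem resolventCoord_injective_of_sections
    (ℓ : ι → ℝ) (x₀ : ℝ) (d : lp (fun _ : ι => 𝕜) ⊤) (hd : ∀ i, d i * ((x₀ : 𝕜) - (ℓ i : 𝕜)) = 1)
    (hd0 : Tendsto (fun i => ‖d i‖) cofinite (𝓝 0))
    (t : ι → ι → 𝕜) {R₀ C₀ : ℝ} (hrow : ∀ i, Summable fun j => ‖t i j‖)
    (hR : ∀ i, ∑' j, ‖t i j‖ ≤ R₀) (hcol : ∀ j, Summable fun i => ‖t i j‖)
    (hC₀ : ∀ j, ∑' i, ‖t i j‖ ≤ C₀) (hR0 : 0 ≤ R₀) (hC0 : 0 ≤ C₀) (hq : R₀ * C₀ < 1)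
    (nbr : ι → Finset ι) (hsymm : ∀ i j, j ∈ nbr i ↔ i ∈ nbr j)
    (ht0 : ∀ i j, j ∉ nbr i → t i j = 0)
    (z : 𝕜) (K : Finset ι) (Binv : (K → 𝕜) →ₗ[𝕜] (K → 𝕜))
    (hBinv : ∀ c : K → 𝕜, Binv (fun i : K => (z - (ℓ i : 𝕜)) * c i -
      ∑ j : K, (t i j * ((x₀ : 𝕜) - (ℓ j : 𝕜))) * c j) = c)
    {α βB βC : ℝ} (hα : 0 ≤ α) (hβB : 0 ≤ βB) (hβC : 0 ≤ βC)
    (hαM : ∀ c : K → 𝕜, ∑ j : K, ‖Binv c j‖ ^ 2 ≤ α ^ 2 * ∑ i : K, ‖c i‖ ^ 2)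
    (hβBM : ∀ e : ι → 𝕜, ∑ j : K, ‖Binv (fun i : K => -∑ j ∈ nbr i \ K,
        (t i j * ((x₀ : 𝕜) - (ℓ j : 𝕜))) * e j) j‖ ^ 2 ≤
        βB ^ 2 * ∑ j ∈ K.biUnion nbr \ K, ‖e j‖ ^ 2)
    (hβCM : ∀ c : K → 𝕜, ∑ i ∈ K.biUnion nbr \ K,
      ‖∑ j : K, (t i j * ((x₀ : 𝕜) - (ℓ j : 𝕜))) * Binv c j‖ ^ 2 ≤ βC ^ 2 * ∑ i : K, ‖c i‖ ^ 2)
    {s MU2 : ℝ} (hMU2 : 0 < MU2) (sh : Finset ι)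
    (hshellM : ∀ e : ι → 𝕜, (∀ i ∈ K, e i = 0) →
      MU2 * ∑ i ∈ sh, ‖e i‖ ^ 2 ≤ ∑ i ∈ sh, (RCLike.re z - ℓ i - s) * ‖e i‖ ^ 2 -
        RCLike.re (∑ i ∈ K.biUnion nbr \ K,
          conj (∑ j : K, (t i j * ((x₀ : 𝕜) - (ℓ j : 𝕜))) *
            Binv (fun i : K => ∑ j ∈ nbr i \ K, (t i j * ((x₀ : 𝕜) - (ℓ j : 𝕜))) * e j) j) *
          e i))
    (htail : ∀ i, i ∉ K → i ∉ sh → MU2 ≤ RCLike.re z - ℓ i - s)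
    (hA : ∀ (F : Finset ι) (e : ι → 𝕜),
      RCLike.re (∑ i ∈ F, ∑ j ∈ F, conj (e i) * (t i j * ((x₀ : 𝕜) - (ℓ j : 𝕜))) * e j) ≤
        s * ∑ i ∈ F, ‖e i‖ ^ 2) :
    ∀ T' : H →L[𝕜] H, (∀ i j, ⟪b i, T' (b j)⟫_𝕜 = t i j) →
      (∀ T'' : H →L[𝕜] H, (∀ i j, ⟪b i, T'' (b j)⟫_𝕜 = t i j) → T'' = T') →
      ∀ w, ((1 : H →L[𝕜] H) - T' - ((x₀ : 𝕜) - z) • b.diagonalCLM d) w = 0 → w = 0 := by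
  obtain ⟨T, hTt, -, Rinv, -, h2, -⟩ :=
    BorderedEigenpairPairingSections.resolvent_inverse_of_sections_of_sections b ℓ x₀ d hd hd0 t
      hrow hR hcol hC₀ hR0 hC0 hq nbr hsymm ht0 z K Binv hBinv hα hβB hβC hαM hβBM hβCM hMU2 sh
      hshellM htail hA
  intro T' hT' hT'u w hw
  have hTT' : T = T' := hT'u T hTt
  subst hTT'
  calc w = Rinv (((1 : H →L[𝕜] H) - T - ((x₀ : 𝕜) - z) • b.diagonalCLM d) w) := (h2 w).symm
    _ = 0 := by rw [hw, map_zero]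

/-! ## §2 GROUP-A END-TO-END from matrix data -/

/-- **SKEW-CUT X0 CERTIFICATE END-TO-END FROM MATRIX DATA.**
`SkewCutGalerkinFromSections.exists_smooth_eigenvector_Ioo_of_sections'` with its operator-form
bracket-end hypothesis `hinj` replaced by Theorem-R matrix data at the two REAL ends `a`, `e`
(left inverse of the Galerkin matrix with bounds `α, β_B, β_C`; shell inequality with `MU2 > 0`;
tail constant) and the SECTION pairing hypothesis on the first-order matrix
`a_ij = t_ij (x₀ − ℓ_j)`; conclusion verbatim: a bounded `T` with matrix `t`, an eigenvalue
`λ ∈ (a, e)` of `L₀ + A` in coordinates with a unit `H^∞` eigenvector. -/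
theorem exists_smooth_eigenvector_Ioo_of_sections_of_resolvent_data
    (ℓ : ι → ℝ) (x₀ : ℝ) (d : lp (fun _ : ι => 𝕜) ⊤) (hd : ∀ i, d i * ((x₀ : 𝕜) - (ℓ i : 𝕜)) = 1)
    (hd0 : Tendsto (fun i => ‖d i‖) cofinite (𝓝 0))
    (t : ι → ι → 𝕜) {R₀ C₀ : ℝ} (hrow : ∀ i, Summable fun j => ‖t i j‖)
    (hR : ∀ i, ∑' j, ‖t i j‖ ≤ R₀) (hcol : ∀ j, Summable fun i => ‖t i j‖)
    (hC₀ : ∀ j, ∑' i, ‖t i j‖ ≤ C₀) (hR0 : 0 ≤ R₀) (hC0 : 0 ≤ C₀) (hq : R₀ * C₀ < 1)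
    (nbr : ι → Finset ι) (hsymm : ∀ i j, j ∈ nbr i ↔ i ∈ nbr j) {W : ℕ}
    (hW : ∀ i, (nbr i).card ≤ W) (ht0 : ∀ i j, j ∉ nbr i → t i j = 0)
    (wgt : ι → ℝ) (hw0 : ∀ i, 0 ≤ wgt i) (hwℓ : ∀ i, wgt i ^ 2 ≤ 1 + |ℓ i|) {Kg : ℝ}
    (hK : 0 ≤ Kg) (ha : ∀ i j, j ∈ nbr i → ‖t i j * ((x₀ : 𝕜) - (ℓ j : 𝕜))‖ ≤ Kg * wgt j)
    {L : ℝ} (hLnn : 0 ≤ L) (hL : ∀ i j, j ∈ nbr i → wgt i ≤ L * wgt j)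
    {M : ℝ} (hM : ∀ i, ‖d i‖ * wgt i ≤ M)
    -- matrix eigenpairs of the finite sections
    (F : ℕ → Finset ι) (hF : Monotone F) (hFex : ∀ i, ∃ n, i ∈ F n)
    (c : ℕ → ι → 𝕜) (xs : ℕ → ℝ) {a e : ℝ} (hxs : ∀ n, xs n ∈ Set.Icc a e)
    (heig : ∀ n, ∀ i ∈ F n, (ℓ i : 𝕜) * c n i +
      ∑ j ∈ F n, (t i j * ((x₀ : 𝕜) - (ℓ j : 𝕜))) * c n j = (xs n : 𝕜) * c n i)
    (hnorm : ∀ n, ∑ j ∈ F n, ‖c n j‖ ^ 2 = 1) {C : ℝ} (hCnn : 0 ≤ C)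
    (hgraph : ∀ n, ∑ j ∈ F n, ‖((x₀ : 𝕜) - (ℓ j : 𝕜)) * c n j‖ ^ 2 ≤ C ^ 2)
    -- the section pairing hypothesis on the first-order matrix
    {s : ℝ}
    (hA : ∀ (G : Finset ι) (u : ι → 𝕜),
      RCLike.re (∑ i ∈ G, ∑ j ∈ G, conj (u i) * (t i j * ((x₀ : 𝕜) - (ℓ j : 𝕜))) * u j) ≤
        s * ∑ i ∈ G, ‖u i‖ ^ 2)
    -- Theorem-R data at the end `a`
    (Ka : Finset ι) (Binva : (Ka → 𝕜) →ₗ[𝕜] (Ka → 𝕜))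
    (hBinva : ∀ v : Ka → 𝕜, Binva (fun i : Ka => ((a : 𝕜) - (ℓ i : 𝕜)) * v i -
      ∑ j : Ka, (t i j * ((x₀ : 𝕜) - (ℓ j : 𝕜))) * v j) = v)
    {αa βBa βCa : ℝ} (hαa : 0 ≤ αa) (hβBa : 0 ≤ βBa) (hβCa : 0 ≤ βCa)
    (hαMa : ∀ v : Ka → 𝕜, ∑ j : Ka, ‖Binva v j‖ ^ 2 ≤ αa ^ 2 * ∑ i : Ka, ‖v i‖ ^ 2)
    (hβBMa : ∀ u : ι → 𝕜, ∑ j : Ka, ‖Binva (fun i : Ka => -∑ j ∈ nbr i \ Ka,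
        (t i j * ((x₀ : 𝕜) - (ℓ j : 𝕜))) * u j) j‖ ^ 2 ≤
        βBa ^ 2 * ∑ j ∈ Ka.biUnion nbr \ Ka, ‖u j‖ ^ 2)
    (hβCMa : ∀ v : Ka → 𝕜, ∑ i ∈ Ka.biUnion nbr \ Ka,
      ‖∑ j : Ka, (t i j * ((x₀ : 𝕜) - (ℓ j : 𝕜))) * Binva v j‖ ^ 2 ≤ βCa ^ 2 * ∑ i : Ka, ‖v i‖ ^ 2)
    {MU2a : ℝ} (hMU2a : 0 < MU2a) (sha : Finset ι)
    (hshellMa : ∀ u : ι → 𝕜, (∀ i ∈ Ka, u i = 0) →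
      MU2a * ∑ i ∈ sha, ‖u i‖ ^ 2 ≤ ∑ i ∈ sha, (a - ℓ i - s) * ‖u i‖ ^ 2 -
        RCLike.re (∑ i ∈ Ka.biUnion nbr \ Ka,
          conj (∑ j : Ka, (t i j * ((x₀ : 𝕜) - (ℓ j : 𝕜))) *
            Binva (fun i : Ka => ∑ j ∈ nbr i \ Ka, (t i j * ((x₀ : 𝕜) - (ℓ j : 𝕜))) * u j) j) *
          u i))
    (htaila : ∀ i, i ∉ Ka → i ∉ sha → MU2a ≤ a - ℓ i - s)
    -- Theorem-R data at the end `e`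
    (Ke : Finset ι) (Binve : (Ke → 𝕜) →ₗ[𝕜] (Ke → 𝕜))
    (hBinve : ∀ v : Ke → 𝕜, Binve (fun i : Ke => ((e : 𝕜) - (ℓ i : 𝕜)) * v i -
      ∑ j : Ke, (t i j * ((x₀ : 𝕜) - (ℓ j : 𝕜))) * v j) = v)
    {αe βBe βCe : ℝ} (hαe : 0 ≤ αe) (hβBe : 0 ≤ βBe) (hβCe : 0 ≤ βCe)
    (hαMe : ∀ v : Ke → 𝕜, ∑ j : Ke, ‖Binve v j‖ ^ 2 ≤ αe ^ 2 * ∑ i : Ke, ‖v i‖ ^ 2)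
    (hβBMe : ∀ u : ι → 𝕜, ∑ j : Ke, ‖Binve (fun i : Ke => -∑ j ∈ nbr i \ Ke,
        (t i j * ((x₀ : 𝕜) - (ℓ j : 𝕜))) * u j) j‖ ^ 2 ≤
        βBe ^ 2 * ∑ j ∈ Ke.biUnion nbr \ Ke, ‖u j‖ ^ 2)
    (hβCMe : ∀ v : Ke → 𝕜, ∑ i ∈ Ke.biUnion nbr \ Ke,
      ‖∑ j : Ke, (t i j * ((x₀ : 𝕜) - (ℓ j : 𝕜))) * Binve v j‖ ^ 2 ≤ βCe ^ 2 * ∑ i : Ke, ‖v i‖ ^ 2)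
    {MU2e : ℝ} (hMU2e : 0 < MU2e) (she : Finset ι)
    (hshellMe : ∀ u : ι → 𝕜, (∀ i ∈ Ke, u i = 0) →
      MU2e * ∑ i ∈ she, ‖u i‖ ^ 2 ≤ ∑ i ∈ she, (e - ℓ i - s) * ‖u i‖ ^ 2 -
        RCLike.re (∑ i ∈ Ke.biUnion nbr \ Ke,
          conj (∑ j : Ke, (t i j * ((x₀ : 𝕜) - (ℓ j : 𝕜))) *
            Binve (fun i : Ke => ∑ j ∈ nbr i \ Ke, (t i j * ((x₀ : 𝕜) - (ℓ j : 𝕜))) * u j) j) *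
          u i))
    (htaile : ∀ i, i ∉ Ke → i ∉ she → MU2e ≤ e - ℓ i - s) :
    ∃ T : H →L[𝕜] H, (∀ i j, ⟪b i, T (b j)⟫_𝕜 = t i j) ∧ ‖T‖ ≤ Real.sqrt (R₀ * C₀) ∧
      ∃ lam ∈ Set.Ioo a e, ∃ v : H, ‖v‖ = 1 ∧
        (∀ i, (ℓ i : 𝕜) * ⟪b i, v⟫_𝕜 +
            ∑ j ∈ nbr i, (t i j * ((x₀ : 𝕜) - (ℓ j : 𝕜))) * ⟪b j, v⟫_𝕜 = (lam : 𝕜) * ⟪b i, v⟫_𝕜) ∧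
        ∀ s : ℕ, Summable fun i => wgt i ^ (2 * s) * ‖⟪b i, v⟫_𝕜‖ ^ 2 := by
  have hrea : RCLike.re ((a : ℝ) : 𝕜) = a := RCLike.ofReal_re a
  have hree : RCLike.re ((e : ℝ) : 𝕜) = e := RCLike.ofReal_re e
  -- injectivity at the two ends from Theorem R
  have hinja := resolventCoord_injective_of_sections b ℓ x₀ d hd hd0 t hrow hR hcol hC₀ hR0 hC0 hq
    nbr hsymm ht0 ((a : ℝ) : 𝕜) Ka Binva hBinva hαa hβBa hβCa hαMa hβBMa hβCMa hMU2a sha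
    (fun u hu => by rw [hrea]; exact hshellMa u hu)
    (fun i hi hi' => by rw [hrea]; exact htaila i hi hi') hA
  have hinje := resolventCoord_injective_of_sections b ℓ x₀ d hd hd0 t hrow hR hcol hC₀ hR0 hC0 hq
    nbr hsymm ht0 ((e : ℝ) : 𝕜) Ke Binve hBinve hαe hβBe hβCe hαMe hβBMe hβCMe hMU2e she
    (fun u hu => by rw [hree]; exact hshellMe u hu)
    (fun i hi hi' => by rw [hree]; exact htaile i hi hi') hA
  exact SkewCutGalerkinFromSections.exists_smooth_eigenvector_Ioo_of_sections' b ℓ x₀ d hd hd0 t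
    hrow hR hcol hC₀ hR0 hC0 hq nbr hsymm hW ht0 wgt hw0 hwℓ hK ha hLnn hL hM F hF hFex c xs hxs
    heig hnorm hCnn hgraph
    fun T' hT' _ _ hT'u => ⟨hinja T' hT' hT'u, hinje T' hT' hT'u⟩

end Summit.NavierStokesRegularity.FluidComputer.SkewCutGalerkinFromResolventData

end
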